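import Literature.NumberTheory.EllipticCurves.Wuthrich2014.MainConjectureConverseProofs
import Literature.NumberTheory.EllipticCurves.Wuthrich2014.PAdicBSDInequalityProofs
import Literature.NumberTheory.EllipticCurves.PAdicGrossZagier
import Literature.NumberTheory.EllipticCurves.GrossZagierRationalPoint
import Literature.NumberTheory.EllipticCurves.RegulatorProofs
import Literature.NumberTheory.EllipticCurves.RegulatorBasisProofs
import Literature.NumberTheory.EllipticCurves.MordellWeilTheoremProofs
import Literature.NumberTheory.EllipticCurves.HeightsProofs
import Literature.NumberTheory.EllipticCurves.MordellWeilRankZeroProofs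
import Literature.NumberTheory.EllipticCurves.CanonicalPAdicHeightHolds
import HarnessLib

/-!
# Rank ONE at a reducible good ordinary prime `p ≥ 5`, part 1 (the engine): Perrin-Riou's comparison,
# the Schneider certificate, and the cofactor identity `ord_p #Ш_an = ord_p h(0) + ord_p #Ш`

`Proofs` companion (theorems only; no new definition, no new named fact — D-0014/D-0026) of
`Wuthrich2014.ReducibleDivisibility` (C. Wuthrich, Doc. Math. 19 (2014), Thm. 16),
`IwasawaLeadingTerm` (Perrin-Riou–Schneider as printed by Balakrishnan–Müller–Stein, Math. Comp. 85
(2016), Thm. 1.7: `Schneider1985_order_charGenerator`) and `PAdicGrossZagier` (B. Perrin-Riou,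
Invent. Math. 89 (1987), §1.4, Cor. 1.8 in leading-term form over `ℚ`:
`perrinRiou_rankOne_leadingTerms`). HONEST FRAMING (BSD rank-≤1 residual cell `b2b-bsdres`, unit
`b2b-bsdres-x1b`, prover B, GEN 3, independent patchwork — no Keller–Yin input anywhere): the cell
deletes the COMBINATION-SHAPED residual classes of the rank-`≤ 1` BSD formula STRICTLY from published
theorems and TYPES the remainder; this is not "finishing BSD".

This is the ENGINE file (theorems `exists_rat_leadingTerms_of_analyticRank_eq_one`,
`coeff_one_padicLFunction_ne_zero_iff_schneider`, `constantCoeff_padicLFunction_eq_zero_of_analyticRank_eq_one`,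
`exists_cofactor_of_mem_charIdeal_of_rank_one`); the consequences in Miller's currency are in
`Wuthrich2014/RankOneConverseProofs.lean`.

**What the pair of files adds (rank one).** Gen 1 of this unit proved the `p`-adic BSD INEQUALITY at a
reducible good ordinary `p ≥ 5` in the `p`-ADIC currency (`padicBSD_inequality_of_charIdeal_dvd`:
`#Ш[p^∞] ∣ p-adic analytic Ш`, given `ord_{T=0} L_p = rank`); gen 2 proved, in rank ZERO, that the
reverse inequality is EQUIVALENT to Mazur's main conjecture (`mainConjecture_iff_bsdp`). Here both
are carried to analytic rank ONE in the CLASSICAL currency of Miller's `BSD(E,p)`, using Perrin-Riou's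
`p`-adic Gross–Zagier theorem to compare `[T¹]L_p(E,T)/Reg_p` with `L'(E,1)/(Ω_E Reg_∞)` (they are the
SAME rational number times `(1 - α⁻¹)²`, resp. `1`: `exists_rat_leadingTerms_of_analyticRank_eq_one`,
a Literature-level copy of the Summits theorem `leadingTerm_consistency_of_rank_one`). Let `W` be a
globally minimal model of `E/ℚ`, `p ≥ 5` good ordinary with `E[p]` reducible, `ord_{s=1} L(E,s) = 1`,
and assume Schneider's non-degeneracy for THE canonical cyclotomic `p`-adic height (`SchneiderConjecture
Dh`, `Reg_p(E) ≠ 0`; equivalently `[T¹]L_p(f,α) ≠ 0` — `coeff_one_padicLFunction_ne_zero_iff_schneider` —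
a per-curve `p`-adic computation that certifies itself when true). Then, granted the PUBLISHED named
facts Wuthrich Thm. 16 (`hW16`), Perrin-Riou–Schneider (`hS`), Perrin-Riou 1987 (`hPR`),
Gross–Zagier–Kolyvagin (`hGZK`), modularity (`hmod`), the chain closes in Miller's currency
(consequences listed in `Wuthrich2014/RankOneConverseProofs.lean`).

Mechanism (`exists_cofactor_of_mem_charIdeal_of_rank_one`, the engine): for `g ∈ char_Λ X = (f_E)` with
`ι g = ϖ · L_p(f,α)` (`ϖ · Ω_E = Ω⁺_f`) write `g = h · f_E`. `L(E,1) = 0` kills the constant term of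
`L_p` (Mazur–Swinnerton-Dyer interpolation) and the certificate makes `ord_T L_p = 1 = rank E(ℚ)`
(GZK), so `ord_T f_E = 1`, `h(0) ≠ 0`, and Perrin-Riou–Schneider's leading term reads
`[T¹]f_E · log_p γ · #E(ℚ)_tors² ∼ (1 - α⁻¹)² · #Ш[p^∞] · Reg_p · ∏ c_ℓ`; Perrin-Riou's comparison
`[T¹]L_p · log_p γ = q (1 - α⁻¹)² Reg_p`, `L'(E,1) = q Ω⁺_f Reg_∞` (one `q ∈ ℚ^×`) turns this into
`#Ш(E/ℚ)_an = q ϖ #E(ℚ)_tors²/∏ c_ℓ = h(0) · u · #Ш[p^∞]` in `ℚ_p` (`u ∈ ℤ_p^×`), i.e.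
`ord_p #Ш_an = ord_p h(0) + ord_p #Ш` with `ord_p h(0) ≥ 0`; and `ord_p h(0) = 0 ⟺ h ∈ Λ^× ⟺ (g) = (f_E)`.
Printed loci of the argument: Perrin-Riou 1987 §1.4 (Cor. 1.8: the comparison of the two leading
terms, quoted by Stein–Wuthrich 2013 §9 as "a theorem of Perrin-Riou asserts the equality of rational
numbers `(1/Reg) L'(E,1)/Ω_E = (1/Reg_p) (L_p'(E,0)/(1-1/α)²) log κ(γ)`"); Stein–Wuthrich 2013 §9 (the
rank-one `p`-adic BSD inequality under Kato's divisibility); Wuthrich 2014 §6 (the reducible case);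
Schneider 1985 / Perrin-Riou (the leading term of the characteristic series).

References: [Wuthrich2014] Thm. 16 (p. 393), §6 (p. 400); [PerrinRiou1987] Thm. 1.3, §1.4 Cor. 1.8;
[BalakrishnanMullerStein2015] Thm. 1.7; [SteinWuthrich2013] §9; [GreenbergVatsal2000] Thm. (1.3);
[Miller2011LMS] Def. 1.1.
-/

set_option autoImplicit false

noncomputable section

open scoped Classical MatrixGroups ModularForm

open CongruenceSubgroup WeierstrassCurve Literature.NumberTheory.EllipticCurves
  Literature.NumberTheory.EllipticCurves.ModularForms
  Literature.NumberTheory.EllipticCurves.Rank1Residual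

namespace Literature.NumberTheory.EllipticCurves.Wuthrich2014

open WeierstrassCurve.Affine.Point

/-! ### Perrin-Riou's comparison in analytic rank one (Literature-level copy) -/

/-- **One rational number for both leading terms (analytic rank one).** For `W/ℚ` globally minimal,
`p ≥ 5` good ordinary, `ord_{s=1} L(E,s) = 1`, THE canonical `p`-adic height datum `Dh` and a newform `f`
of `E`: there is `q ∈ ℚ`, `q ≠ 0`, with `L'(E,1) = L^{(r)}(E,1)/r! = q · Ω⁺_f · Reg_∞(E)` and
`[T¹]L_p(f,α,T) · log_p γ = q · (1 - α⁻¹)² · Reg_p(E, Dh)`. From Perrin-Riou's theorem (`hPR`: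
`L'(E,1) = c Ω⁺_f ĥ(P)`, `[T¹]L_p log_p γ = c (1-α⁻¹)² ⟨P,P⟩` for one non-torsion `P`) by writing
`P = m P₀ + T` on a Mordell–Weil basis `{P₀}` of the rank-one group `E(ℚ)` (rank one by
Gross–Zagier–Kolyvagin `hGZK`): `ĥ(P) = m² Reg_∞`, `⟨P,P⟩ = m² Reg_p`, `q = c m²`; `q ≠ 0` because
`L'(E,1) ≠ 0`. Literature-level twin of `Summit.….leadingTerm_consistency_of_rank_one` (route
LeadingTerm), which cannot be imported below the Summits layer. [cite: PerrinRiou1987, §1.4 Cor. 1.8]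
[cite: SteinWuthrich2013, §9] -/
theorem exists_rat_leadingTerms_of_analyticRank_eq_one (hPR : perrinRiou_rankOne_leadingTerms)
    (hGZK : rank_eq_analyticRank_of_analyticRank_le_one)
    (W : WeierstrassCurve ℚ) [W.IsElliptic] [W.IsGloballyMinimal] (p : ℕ) [Fact p.Prime]
    (hp : 5 ≤ p) (hord : IsOrdinaryAt W p) (han : W.analyticRank = 1)
    (Dh : PAdicHeightData W p) (hDh : Dh.IsCanonical) {N : ℕ} [NeZero N]
    (f : CuspForm (Gamma0 N) 2) (hf : IsNewformOf W f) :
    ∃ q : ℚ, q ≠ 0 ∧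
      W.leadingLCoeff = (((q : ℝ) * plusPeriod f * W.regulator : ℝ) : ℂ) ∧
      PowerSeries.coeff 1 (padicLFunction f (unitRoot W p : ℚ_[p])) *
          padicLog p (cyclotomicGenerator p) =
        (q : ℚ_[p]) * (1 - (unitRoot W p : ℚ_[p])⁻¹) ^ 2 * padicRegulator Dh := by
  -- adapted from Summits/BirchSwinnertonDyer/BirchSwinnertonDyer/Theorems/LeadingTermRankLeOne.lean
  have hr : W.mordellWeilRank = 1 := by rw [(hGZK W han.le).1, han]
  obtain ⟨P, c, -, harch, hpad⟩ := hPR W p hp hord han Dh hDh f hf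
  obtain ⟨B, hB⟩ := W.exists_isMordellWeilBasis_holds
  have hcard : Fintype.card (Fin W.mordellWeilRank) = 1 := by rw [Fintype.card_fin, hr]
  let k : Fin W.mordellWeilRank := ⟨0, by omega⟩
  have huniq : ∀ i : Fin W.mordellWeilRank, i = k := fun i ↦ Fin.ext (by have := i.2; omega)
  obtain ⟨m, T, hT, hPdecomp, hreal⟩ : ∃ (m : ℤ) (T : W.toAffine.Point), IsOfFinAddOrder T ∧
      P = m • B k + T ∧ P.canonicalHeight = (m : ℝ) ^ 2 * W.regulator := by
    letI : DecidableEq ℚ := fun a b ↦ Classical.propDecidable (a = b)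
    obtain ⟨m, hm⟩ : ∃ m : ℤ, m • (QuotientAddGroup.mk (B k) : mordellWeilModTorsion W) =
        QuotientAddGroup.mk P := by
      have hmem : (QuotientAddGroup.mk P : mordellWeilModTorsion W) ∈
          Submodule.span ℤ (Set.range (QuotientAddGroup.mk ∘ B :
            Fin W.mordellWeilRank → mordellWeilModTorsion W)) := by
        rw [hB.2]; exact Submodule.mem_top
      have hrange : Set.range (QuotientAddGroup.mk ∘ B :
          Fin W.mordellWeilRank → mordellWeilModTorsion W) = {QuotientAddGroup.mk (B k)} := by
        ext x
        simp only [Set.mem_range, Set.mem_singleton_iff, Function.comp_apply]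
        constructor
        · rintro ⟨i, rfl⟩; rw [huniq i]
        · rintro rfl; exact ⟨k, rfl⟩
      rw [hrange] at hmem
      exact Submodule.mem_span_singleton.mp hmem
    set T : W.toAffine.Point := -(m • B k) + P with hT_def
    have hT : IsOfFinAddOrder T := by
      have h1 : (QuotientAddGroup.mk (m • B k) : mordellWeilModTorsion W) =
          QuotientAddGroup.mk P := by
        rw [← hm, QuotientAddGroup.mk_zsmul]
      exact (AddCommGroup.mem_torsion _).mp (QuotientAddGroup.eq.mp h1)
    have hPdecomp : P = m • B k + T := by rw [hT_def]; abel
    have hReg : W.regulator = heightPairing (B k) (B k) := by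
      rw [← hB.regulatorOf_eq_regulator, regulatorOf, Matrix.det_eq_elem_of_card_eq_one hcard k,
        heightPairingMatrix_apply]
    have e1 : ∀ R, heightPairing R P = (m : ℝ) * heightPairing R (B k) := fun R ↦ by
      rw [hPdecomp, heightPairing_add_right, heightPairing_zsmul_right,
        heightPairing_eq_zero_of_isOfFinAddOrder_right R hT, add_zero]
    have hreal : P.canonicalHeight = (m : ℝ) ^ 2 * W.regulator := by
      rw [← heightPairing_self_holds P, e1, heightPairing_symm, e1, hReg]
      ring
    refine ⟨m, T, ?_, ?_, hreal⟩
    · convert hT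
    · convert hPdecomp
  have hRegp : padicRegulator Dh = Dh.pairing (B k) (B k) := by
    rw [← padicRegulatorOf_eq_padicRegulator_holds Dh hB, padicRegulatorOf]
    convert Matrix.det_eq_elem_of_card_eq_one (A := Dh.pairingMatrix B) hcard k
    rfl
  have e2 : ∀ R, Dh.pairing R P = (m : ℚ_[p]) * Dh.pairing R (B k) := fun R ↦ by
    rw [hPdecomp, map_add, map_zsmul, Dh.map_torsion_right R T hT, add_zero, zsmul_eq_mul]
  have hpadic : Dh.pairing P P = (m : ℚ_[p]) ^ 2 * padicRegulator Dh := by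
    rw [e2, Dh.symm P (B k), e2, hRegp]
    ring
  obtain ⟨hlead, hderiv⟩ := leadingLCoeff_eq_deriv_of_analyticRank_eq_one han
  refine ⟨c * m ^ 2, ?_, ?_, ?_⟩
  · intro hq
    apply hderiv
    rw [harch, hreal]
    have h0 : (c : ℝ) * (m : ℝ) ^ 2 = 0 := by exact_mod_cast hq
    have : (c : ℝ) * plusPeriod f * ((m : ℝ) ^ 2 * W.regulator) = 0 := by
      rw [show (c : ℝ) * plusPeriod f * ((m : ℝ) ^ 2 * W.regulator) =
        ((c : ℝ) * (m : ℝ) ^ 2) * (plusPeriod f * W.regulator) by ring, h0, zero_mul]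
    rw [this, Complex.ofReal_zero]
  · rw [hlead, harch, hreal]
    push_cast
    ring
  · rw [hpad, hpadic]
    push_cast
    ring

/-- **The certificate, two spellings.** In the situation of
`exists_rat_leadingTerms_of_analyticRank_eq_one`: `[T¹]L_p(f,α,T) ≠ 0` iff Schneider's non-degeneracy
`Reg_p(E, Dh) ≠ 0` (`SchneiderConjecture Dh`) — since `[T¹]L_p · log_p γ = q (1-α⁻¹)² Reg_p` with
`q ≠ 0`, `log_p γ ≠ 0` (`p` odd) and `1 - α⁻¹ ≠ 0`. Either is a per-curve `p`-adic computation
(Stein–Wuthrich 2013 §§3–4: `L_p` to precision; §4.1: `Reg_p` by the sigma function).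
[cite: PerrinRiou1987, §1.4 Cor. 1.8] [cite: SteinWuthrich2013, §4.1 and §9] -/
theorem coeff_one_padicLFunction_ne_zero_iff_schneider (hPR : perrinRiou_rankOne_leadingTerms)
    (hGZK : rank_eq_analyticRank_of_analyticRank_le_one)
    (W : WeierstrassCurve ℚ) [W.IsElliptic] [W.IsGloballyMinimal] (p : ℕ) [Fact p.Prime]
    (hp : 5 ≤ p) (hord : IsOrdinaryAt W p) (han : W.analyticRank = 1)
    (Dh : PAdicHeightData W p) (hDh : Dh.IsCanonical) {N : ℕ} [NeZero N]
    (f : CuspForm (Gamma0 N) 2) (hf : IsNewformOf W f) :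
    PowerSeries.coeff 1 (padicLFunction f (unitRoot W p : ℚ_[p])) ≠ 0 ↔ SchneiderConjecture Dh := by
  obtain ⟨q, hq0, -, hpad⟩ :=
    exists_rat_leadingTerms_of_analyticRank_eq_one hPR hGZK W p hp hord han Dh hDh f hf
  have hpP : p.Prime := Fact.out
  obtain ⟨u, hu⟩ := exists_unit_padicLog_cyclotomicGenerator p (show p ≠ 2 by omega)
  have hlog : padicLog p (cyclotomicGenerator p : ℚ_[p]) ≠ 0 := by
    rw [hu]; exact mul_ne_zero (Nat.cast_ne_zero.mpr hpP.ne_zero) (coe_units_ne_zero p u)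
  obtain ⟨u₂, hu₂⟩ := exists_unit_one_sub_unitRoot_inv p W hord
  have hε : (1 - (unitRoot W p : ℚ_[p])⁻¹) ^ 2 ≠ 0 := by
    rw [hu₂]
    refine pow_ne_zero 2 (mul_ne_zero (coe_units_ne_zero p u₂) ?_)
    exact_mod_cast (W.reductionPointCount_pos p).ne'
  have hqQ : (q : ℚ_[p]) ≠ 0 := by exact_mod_cast hq0
  unfold SchneiderConjecture
  constructor
  · intro h1 hreg
    apply h1
    rw [hreg, mul_zero] at hpad
    exact (mul_eq_zero.mp hpad).resolve_right hlog
  · intro hreg h1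
    apply hreg
    rw [h1, zero_mul] at hpad
    exact (mul_eq_zero.mp hpad.symm).resolve_left (mul_ne_zero hqQ hε)

/-- `L(E,1) = 0` in analytic rank one kills the constant term of the `p`-adic `L`-function:
`L_p(f,α,0) = (1 - α⁻¹)² · [0]⁺_f` (Mazur–Swinnerton-Dyer interpolation, tree theorem
`constantCoeff_padicLFunction_unitRoot`) and `[0]⁺_f · Ω⁺_f = L(E,1) = 0` with `Ω⁺_f > 0`.
[cite: MazurTateTeitelbaum1986Invent, §I.14 (14.3)] -/
theorem constantCoeff_padicLFunction_eq_zero_of_analyticRank_eq_one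
    (W : WeierstrassCurve ℚ) [W.IsElliptic] [W.IsGloballyMinimal] (p : ℕ) [Fact p.Prime]
    (hord : IsOrdinaryAt W p) (han : W.analyticRank = 1) {N : ℕ} [NeZero N]
    (f : CuspForm (Gamma0 N) 2) (hf : IsNewformOf W f) :
    PowerSeries.constantCoeff (padicLFunction f (unitRoot W p : ℚ_[p])) = 0 := by
  have hL0 : W.entireLFunction 1 = 0 := entireLFunction_one_eq_zero_of_analyticRank_eq_one han
  have hper : 0 < plusPeriod f := IsNewform0.plusPeriod_pos_holds hf.1 hf.coeffField_eq_bot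
  have h := hf.entireLFunction_one_eq
  rw [hL0] at h
  have h' : ((ratPlusSymbol f 0 : ℚ) : ℝ) * plusPeriod f = 0 := by exact_mod_cast h.symm
  have hs : (ratPlusSymbol f 0 : ℚ) = 0 := by
    exact_mod_cast (mul_eq_zero.mp h').resolve_right hper.ne'
  rw [constantCoeff_padicLFunction_unitRoot hord hf, hs, Rat.cast_zero, mul_zero]

/-! ### The engine: the cofactor `h` and `ord_p #Ш_an = ord_p h(0) + ord_p #Ш` -/

/-- **The rank-one engine.** Let `W` be globally minimal, `p ≥ 5` good ordinary, `ord_{s=1} L(E,s) = 1`,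
`f` a newform of `E`, `ϖ · Ω_E = Ω⁺_f`, `Dh` the canonical `p`-adic height with `Reg_p ≠ 0` (`hSch`),
`(κ, γ)` cyclotomic, `D` a dual datum with `X` torsion, and `g ∈ char_Λ X` with `ι g = ϖ · L_p(f,α)`
(as supplied by Wuthrich's Thm. 16, or by the main conjecture with `g` a generator). Then for a
generator `f_E` of `char_Λ X` and the cofactor `h` (`g = h · f_E`): `h(0) ≠ 0` and
`#Ш(E/ℚ)_an = s ∈ ℚ^×` with `ord_p s = ord_p h(0) + ord_p #Ш(E/ℚ)`. Inputs: Perrin-Riou–Schneider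
(`hS`, all three clauses), Perrin-Riou 1987 (`hPR`, via `exists_rat_leadingTerms_of_analyticRank_eq_one`),
Gross–Zagier–Kolyvagin (`hGZK`: rank one, `Ш` finite). [cite: BalakrishnanMullerStein2015, Thm. 1.7]
[cite: PerrinRiou1987, §1.4 Cor. 1.8] [cite: SteinWuthrich2013, §9] [cite: Wuthrich2014, §6 (p. 400)] -/
theorem exists_cofactor_of_mem_charIdeal_of_rank_one (hS : Schneider1985_order_charGenerator)
    (hPR : perrinRiou_rankOne_leadingTerms) (hGZK : rank_eq_analyticRank_of_analyticRank_le_one)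
    (W : WeierstrassCurve ℚ) [W.IsElliptic] [W.IsGloballyMinimal] (p : ℕ) [Fact p.Prime]
    (hp : 5 ≤ p) (hgood : W.HasGoodReductionAtPrime p) (hordp : ¬ (p : ℤ) ∣ W.frobeniusTrace p)
    (han : W.analyticRank = 1)
    {κ : ZpExtension ℚ p} {γ : Field.absoluteGaloisGroup ℚ} {N : ℕ} [NeZero N]
    {f : CuspForm (Gamma0 N) 2} (hκ : κ.IsCyclotomic) (hγ : κ.IsTopGenerator γ)
    (hγ' : IsCyclotomicVariable p γ) (hf : IsNewformOf W f) (ϖ : ℚ)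
    (hϖ : (ϖ : ℝ) * W.realPeriodRat = plusPeriod f)
    (Dh : PAdicHeightData W p) (hDh : Dh.IsCanonical) (hSch : SchneiderConjecture Dh)
    (D : W.SelmerDualData κ γ) (hX : D.IsTorsion) (g : IwasawaAlgebra p) (hgmem : g ∈ D.charIdeal)
    (hιg : iwasawaToPowerSeries p g =
      PowerSeries.C ((ϖ : ℚ) : ℚ_[p]) * padicLFunction f (unitRoot W p : ℚ_[p])) :
    ∃ (fE h : IwasawaAlgebra p) (s : ℚ), D.charIdeal = Ideal.span {fE} ∧ fE ≠ 0 ∧ g = h * fE ∧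
      PowerSeries.constantCoeff h ≠ 0 ∧ shaAn W = (s : ℂ) ∧ s ≠ 0 ∧
      padicValRat p s = (((PowerSeries.constantCoeff h : ℤ_[p]) : ℚ_[p])).valuation +
        (padicValNat p W.shaOrder : ℤ) := by
  have hpP : p.Prime := Fact.out
  have hordin : IsOrdinaryAt W p := ⟨hgood, hordp⟩
  -- Gross–Zagier–Kolyvagin: rank one, `Ш` finite
  obtain ⟨hrk, hfin⟩ := hGZK W han.le
  haveI : Finite W.sha := hfin
  set r := W.mordellWeilRank with hr_def
  have hr1 : r = 1 := hrk.trans han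
  set L := padicLFunction f (unitRoot W p : ℚ_[p]) with hL_def
  -- Perrin-Riou's comparison and the certificate
  obtain ⟨q, hq0, hlead, hpad⟩ :=
    exists_rat_leadingTerms_of_analyticRank_eq_one hPR hGZK W p hp hordin han Dh hDh f hf
  have hcoeffL : PowerSeries.coeff 1 L ≠ 0 :=
    (coeff_one_padicLFunction_ne_zero_iff_schneider hPR hGZK W p hp hordin han Dh hDh f hf).mpr hSch
  have hϖ0 : ϖ ≠ 0 := by
    rintro rfl
    have hper : 0 < plusPeriod f := IsNewform0.plusPeriod_pos_holds hf.1 hf.coeffField_eq_bot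
    rw [← hϖ, Rat.cast_zero, zero_mul] at hper
    exact lt_irrefl _ hper
  have hϖQ : (ϖ : ℚ_[p]) ≠ 0 := by exact_mod_cast hϖ0
  -- the Iwasawa module, a generator `fE` of the characteristic ideal, the cofactor `h`
  haveI : Module.Finite (IwasawaAlgebra p) D.X := D.module_finite_holds hγ
  haveI : (Module.charIdeal (IwasawaAlgebra p) D.X).IsPrincipal := charIdeal_isPrincipal_holds p D.X
  obtain ⟨fE, hchar⟩ := Submodule.IsPrincipal.principal (Module.charIdeal (IwasawaAlgebra p) D.X)
  have hchar' : D.charIdeal = Ideal.span {fE} := hchar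
  have hgmem' : g ∈ Ideal.span {fE} := by rw [← hchar']; exact hgmem
  obtain ⟨h, hgh⟩ := Ideal.mem_span_singleton'.mp hgmem'
  -- Perrin-Riou–Schneider, clause 1: `fE = T^r · qq`
  obtain ⟨qq, hqq⟩ := Schneider1985_order_charGenerator.X_pow_dvd hS hp hgood hordp hκ hγ hγ' D hX
    hchar' hDh
  -- coefficients at `T^r` (`r = 1`)
  have hcoeff_g : (PowerSeries.coeff r g : ℤ_[p]) =
      PowerSeries.constantCoeff h * PowerSeries.constantCoeff qq := by
    rw [← hgh, hqq, show h * (PowerSeries.X ^ r * qq) = PowerSeries.X ^ r * (h * qq) by ring,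
      PowerSeries.coeff_X_pow_mul', if_pos le_rfl, Nat.sub_self,
      PowerSeries.coeff_zero_eq_constantCoeff, map_mul]
  have hcoeff_fE : (PowerSeries.coeff r fE : ℤ_[p]) = PowerSeries.constantCoeff qq := by
    rw [hqq, PowerSeries.coeff_X_pow_mul', if_pos le_rfl, Nat.sub_self,
      PowerSeries.coeff_zero_eq_constantCoeff]
  have hcoeff_ιg : ((PowerSeries.coeff r g : ℤ_[p]) : ℚ_[p]) = (ϖ : ℚ_[p]) * PowerSeries.coeff r L := by
    rw [← coeff_iwasawaToPowerSeries p g r, hιg, PowerSeries.coeff_C_mul]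
  have hcoeffLr : PowerSeries.coeff r L ≠ 0 := by rw [hr1]; exact hcoeffL
  have hg_r_ne : (PowerSeries.coeff r g : ℤ_[p]) ≠ 0 := by
    intro h0
    have : ((PowerSeries.coeff r g : ℤ_[p]) : ℚ_[p]) = 0 := by rw [h0]; rfl
    rw [hcoeff_ιg] at this
    exact (mul_ne_zero hϖQ hcoeffLr) this
  have hh0 : PowerSeries.constantCoeff h ≠ 0 := by
    intro h0; apply hg_r_ne; rw [hcoeff_g, h0, zero_mul]
  have hqq0 : PowerSeries.constantCoeff qq ≠ 0 := by
    intro h0; apply hg_r_ne; rw [hcoeff_g, h0, mul_zero]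
  -- `ord_T fE = r`, hence (clause 3) the leading-term identity
  have hordfE : fE.order = r := by
    refine le_antisymm (PowerSeries.order_le r (by rw [hcoeff_fE]; exact hqq0)) ?_
    exact Schneider1985_order_charGenerator.mordellWeilRank_le_order hS hp hgood hordp hκ hγ hγ' D hX
      hchar' hDh
  have hfE0 : fE ≠ 0 := by
    intro e
    rw [e, PowerSeries.order_zero] at hordfE
    exact ENat.top_ne_coe _ hordfE
  have hfinp : Finite (AddCommGroup.primaryComponent W.sha p) := inferInstance
  obtain ⟨u, hu⟩ := Schneider1985_order_charGenerator.leadingCoeff hS hp hgood hordp hκ hγ hγ' D hX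
    hchar' hDh hSch hfinp
  -- abbreviations in `ℚ_p`
  set h0 : ℚ_[p] := ((PowerSeries.constantCoeff h : ℤ_[p]) : ℚ_[p]) with hh0_def
  set lg : ℚ_[p] := padicLog p (cyclotomicGenerator p) ^ r with hlg_def
  set T2 : ℚ_[p] := (W.torsionOrder : ℚ_[p]) ^ 2 with hT2_def
  set ε : ℚ_[p] := (1 - (unitRoot W p : ℚ_[p])⁻¹) ^ 2 with hε_def
  set Shp : ℚ_[p] := (Nat.card (AddCommGroup.primaryComponent W.sha p) : ℚ_[p]) with hShp_def
  set Rg : ℚ_[p] := padicRegulator Dh with hRg_def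
  set Cc : ℚ_[p] := (W.tamagawaProduct : ℚ_[p]) with hCc_def
  -- Perrin-Riou at index `r`: `[T^r]L · log^r = q · ε · Reg_p`
  have hpad' : PowerSeries.coeff r L * lg = (q : ℚ_[p]) * ε * Rg := by
    rw [hlg_def, hr1, pow_one]; exact hpad
  -- the identity `ϖ [T^r]L · lg · T2 = h0 · (u · ε · Shp · Rg · Cc)`
  have key : (ϖ : ℚ_[p]) * PowerSeries.coeff r L * lg * T2 =
      h0 * (((u : ℤ_[p]) : ℚ_[p]) * (ε * (Shp * (Rg * Cc)))) := by
    have e1 : (ϖ : ℚ_[p]) * PowerSeries.coeff r L =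
        h0 * ((PowerSeries.coeff r fE : ℤ_[p]) : ℚ_[p]) := by
      rw [← hcoeff_ιg, hcoeff_g, hcoeff_fE, hh0_def]; push_cast; ring
    calc (ϖ : ℚ_[p]) * PowerSeries.coeff r L * lg * T2
        = h0 * (((PowerSeries.coeff r fE : ℤ_[p]) : ℚ_[p]) * lg * T2) := by rw [e1]; ring
      _ = h0 * (((u : ℤ_[p]) : ℚ_[p]) * (ε * (Shp * (Rg * Cc)))) := by rw [hu]; ring
  -- hence `ϖ q T2 = h0 · u · Shp · Cc` (cancel `ε · Rg ≠ 0`)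
  have hh0ne : h0 ≠ 0 := by
    rw [hh0_def]; intro e; exact hh0 (by exact_mod_cast (PadicInt.coe_eq_zero.mp e))
  obtain ⟨u₂, hu₂⟩ := exists_unit_one_sub_unitRoot_inv p W hordin
  have hε0 : ε ≠ 0 := by
    rw [hε_def, hu₂]
    refine pow_ne_zero 2 (mul_ne_zero (coe_units_ne_zero p u₂) ?_)
    exact_mod_cast (W.reductionPointCount_pos p).ne'
  have hRg0 : Rg ≠ 0 := hSch
  have hShp0 : Shp ≠ 0 := by rw [hShp_def]; exact_mod_cast Nat.card_pos.ne'
  have hCc0 : Cc ≠ 0 := by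
    rw [hCc_def]; exact_mod_cast (W.tamagawaProduct_pos_holds : 0 < W.tamagawaProduct).ne'
  have key2 : (ϖ : ℚ_[p]) * (q : ℚ_[p]) * T2 = h0 * ((u : ℤ_[p]) : ℚ_[p]) * Shp * Cc := by
    apply mul_right_cancel₀ (mul_ne_zero hε0 hRg0)
    calc (ϖ : ℚ_[p]) * (q : ℚ_[p]) * T2 * (ε * Rg)
        = (ϖ : ℚ_[p]) * (PowerSeries.coeff r L * lg) * T2 := by rw [hpad']; ring
      _ = (ϖ : ℚ_[p]) * PowerSeries.coeff r L * lg * T2 := by ring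
      _ = h0 * (((u : ℤ_[p]) : ℚ_[p]) * (ε * (Shp * (Rg * Cc)))) := key
      _ = h0 * ((u : ℤ_[p]) : ℚ_[p]) * Shp * Cc * (ε * Rg) := by ring
  -- the analytic order of `Ш`: `#Ш_an = q ϖ #E(ℚ)_tors² / ∏ c_ℓ`
  set s : ℚ := q * ϖ * (W.torsionOrder : ℚ) ^ 2 / (W.tamagawaProduct : ℚ) with hs_def
  have hΩpos : 0 < W.realPeriodRat := W.realPeriodRat_pos_holds
  have hRegpos : 0 < W.regulator := regulator_pos_holds W
  have htamQ : (W.tamagawaProduct : ℚ) ≠ 0 := by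
    exact_mod_cast (W.tamagawaProduct_pos_holds : 0 < W.tamagawaProduct).ne'
  have hsha : shaAn W = (s : ℂ) := by
    have hΩC : (W.realPeriodRat : ℂ) ≠ 0 := by exact_mod_cast hΩpos.ne'
    have hRegC : (W.regulator : ℂ) ≠ 0 := by exact_mod_cast hRegpos.ne'
    have htamC : (W.tamagawaProduct : ℂ) ≠ 0 := by exact_mod_cast htamQ
    have hper : (plusPeriod f : ℂ) = (ϖ : ℂ) * (W.realPeriodRat : ℂ) := by
      rw [← hϖ]; push_cast; ring
    rw [shaAn_def, hlead, hs_def]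
    push_cast
    rw [hper]
    field_simp
  have hsQ : ((s : ℚ) : ℚ_[p]) = h0 * ((u : ℤ_[p]) : ℚ_[p]) * Shp := by
    have hT2 : T2 = ((W.torsionOrder : ℚ) : ℚ_[p]) ^ 2 := by rw [hT2_def]; push_cast; ring
    have hCcQ : Cc = ((W.tamagawaProduct : ℚ) : ℚ_[p]) := by rw [hCc_def]; push_cast; ring
    have hCc0' : ((W.tamagawaProduct : ℚ) : ℚ_[p]) ≠ 0 := by rw [← hCcQ]; exact hCc0
    rw [hs_def]
    push_cast
    rw [div_eq_iff (by exact_mod_cast hCc0')]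
    have := key2
    rw [hT2, hCcQ] at this
    push_cast at this ⊢
    linear_combination this
  have hs0 : s ≠ 0 := by
    intro e
    have : ((s : ℚ) : ℚ_[p]) = 0 := by rw [e, Rat.cast_zero]
    rw [hsQ] at this
    exact (mul_ne_zero (mul_ne_zero hh0ne (coe_units_ne_zero p u)) hShp0) this
  -- valuations
  have hvS : Shp.valuation = (padicValNat p W.shaOrder : ℤ) := by
    rw [hShp_def, Padic.valuation_natCast, padicValNat_card_addPrimaryComponent,
      WeierstrassCurve.shaOrder]
  have hval := congrArg Padic.valuation hsQ
  rw [Padic.valuation_ratCast, Padic.valuation_mul (mul_ne_zero hh0ne (coe_units_ne_zero p u)) hShp0,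
    Padic.valuation_mul hh0ne (coe_units_ne_zero p u), valuation_coe_units_eq_zero, add_zero,
    hvS] at hval
  exact ⟨fE, h, s, hchar', hfE0, hgh.symm, hh0, hsha, hs0, hval⟩

end Literature.NumberTheory.EllipticCurves.Wuthrich2014

end
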